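import Summits.BirchSwinnertonDyer.BirchSwinnertonDyer.Theorems.EisensteinPrimesGoodLatticeMuLambdaSplit
import Literature.NumberTheory.EllipticCurves.CastellaGrossiLeeSkinner2022.KatzPAdicLFunctionExistence
import HarnessLib

/-!
# Route `EisensteinPrimes` (rung K5), crux 2 `GoodLatticeBDPValue`, line `halves`: the stub
# `stub_muLambda` and the crux BY NAME from LITERATURE FACTS + the three preprint character statements
# — the displayed input [F1b] discharged by the named fact `thm212_exists_isKatzLFunction`

Cell `bsd-eis` (FULL-BSD rank-≤1 programme, `run/shared/lean/pub/bsd-eis/`), seat `bsd-eis-k5-c2`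
(D-0074 group (C) row A). The composition `goodLatticeMuLambdaOnTree_of_split`
(`EisensteinPrimesGoodLatticeMuLambdaSplit.lean`) takes the displayed PUBLISHED input
`∀ p, X1.KellerYinMuLambdaSplit.KatzLFunctionExistsFor p` (existence of the anticyclotomic Katz
`p`-adic `L`-function, CGLS Thm. 2.1.2). That input is now the Literature named fact
`CastellaGrossiLeeSkinner2022.thm212_exists_isKatzLFunction` (binder for binder), so this file
re-exports the composition and the crux with the fact in its place:

* `katzLFunctionExistsFor_of_thm212` — the named fact IS the displayed input (`fun h p _ ↦ h p`);
* `goodLatticeMuLambdaOnTree_of_facts` — `stub_muLambda` (`∀ W p, GoodLatticeMuLambdaOnTree W p`)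
  from the Literature statements [F1b] `thm212_exists_isKatzLFunction` (PUB), [ALG]
  `thm151_algmain_goodLattice_OPEN` (PRE), [AN] `thm222_anacong_goodLattice_OPEN` (PRE at `𝟙̃|_K = 𝟙`,
  PUB off it) and the two character shapes [BRω] `GoodLatticeOmegaSideOnTree`, [BR𝟙]
  `CharMainConjOnTree` (PRE at the anomalous characters);
* `goodLatticeBDPValue_of_facts` — the crux `Theses.EisensteinPrimes.GoodLatticeBDPValue` BY NAME
  from FIVE published Literature facts (Castella–Hsieh 2018 Def. 3.7/Prop. 3.8; Carayol; CGLS 2022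
  proof of Thm. 4.2.2; CGLS 2022 Thm. 5.1.3; CGLS 2022 Thm. 2.1.2) and the PREPRINT statements
  [ALG], [AN], [BRω], [BR𝟙] — the honest residue of row A1.

CONDITIONAL on the named inputs (hypotheses BY NAME; nothing booked; no label moves). Helper
attached to stmt-BirchSwinnertonDyer-19032 (`--supports`).
-/

set_option autoImplicit false
set_option linter.dupNamespace false

noncomputable section

open scoped Classical

open WeierstrassCurve NumberField IsDedekindDomain Field
  Literature.NumberTheory.EllipticCurves Literature.NumberTheory.EllipticCurves.ModularForms
  Literature.NumberTheory.EllipticCurves.Rank1Residual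
  Literature.NumberTheory.EllipticCurves.CastellaGrossiLeeSkinner2022
  Literature.NumberTheory.EllipticCurves.KellerYin2024
  Summit.BirchSwinnertonDyer.Rank1Residual.X1.KellerYinHalves
  Summit.BirchSwinnertonDyer.Rank1Residual.X1.KellerYinMuLambdaSplit

namespace Summit.BirchSwinnertonDyer.BirchSwinnertonDyer.Theorems.EisensteinPrimesMuLambda

/-- **The named fact IS the displayed input**: CGLS Thm. 2.1.2 (`thm212_exists_isKatzLFunction`,
Literature) gives `KatzLFunctionExistsFor p` for every prime `p` — binder for binder.
[cite: CastellaGrossiLeeSkinner2022, Thm. 2.1.2 (arXiv:2008.02571v2 TeX L1015–1041)] -/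
theorem katzLFunctionExistsFor_of_thm212 (h : thm212_exists_isKatzLFunction) (p : ℕ) [Fact p.Prime] :
    KatzLFunctionExistsFor p :=
  h p

/-- **`stub_muLambda` from Literature statements + the two character shapes.** Keller–Yin's `μ = 0`
and `λ`-equality at the good lattice (`∀ W p, GoodLatticeMuLambdaOnTree W p`) from [F1b]
`thm212_exists_isKatzLFunction` (CGLS Thm. 2.1.2, PUBLISHED), [ALG] `thm151_algmain_goodLattice_OPEN`
(KY Thm. 1.5.1, PREPRINT), [AN] `thm222_anacong_goodLattice_OPEN` (KY Thm. 2.2.2; PUBLISHED off the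
trivial character as CGLS Thm. 2.2.2), [BRω] `GoodLatticeOmegaSideOnTree`, [BR𝟙] `CharMainConjOnTree`
(KY Thm. 1.2.2 / proof of Thm. 2.2.3, PREPRINT at the anomalous characters) — via
`goodLatticeMuLambdaOnTree_of_split`. CONDITIONAL; nothing booked. [claim: KellerYin2024, status: under-review]
[cite: KellerYin2024, Thm. 1.5.1, Thm. 1.2.2, Thms. 2.2.1–2.2.3, proof of Thm. 3.0.8 (arXiv:2402.12781v2 TeX L1631–1640)]
[cite: CastellaGrossiLeeSkinner2022, Thm. 2.1.2, Thm. 2.2.2] -/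
theorem goodLatticeMuLambdaOnTree_of_facts (hKatz : thm212_exists_isKatzLFunction)
    (halg : thm151_algmain_goodLattice_OPEN) (han : thm222_anacong_goodLattice_OPEN)
    (hω : ∀ (W : WeierstrassCurve ℚ) [W.IsElliptic] [W.IsGloballyMinimal] (p : ℕ) [Fact p.Prime],
      GoodLatticeOmegaSideOnTree W p)
    (hbr : ∀ (p : ℕ) [Fact p.Prime], CharMainConjOnTree p)
    (W : WeierstrassCurve ℚ) [W.IsElliptic] [W.IsGloballyMinimal] (p : ℕ) [Fact p.Prime] :
    GoodLatticeMuLambdaOnTree W p :=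
  goodLatticeMuLambdaOnTree_of_split halg han hω hbr
    (fun p _ ↦ katzLFunctionExistsFor_of_thm212 hKatz p) W p

/-- **The crux BY NAME from five PUBLISHED Literature facts and the PREPRINT character statements.**
`Theses.EisensteinPrimes.GoodLatticeBDPValue` (= Keller–Yin Thm. 3.0.8 at the good lattice, read at
`𝟙`) from: `castellaHsieh2018_exists_isBDPLFunction` (BDP frame exists), Carayol
(`IsNewformOf.level_eq_conductorNorm`), `proofThm422_exists_isBDPLFunction_isTorsion_charIdeal_dvd`
(one divisibility), `thm513_exists_isBDPLFunction_valueAtOne` (BDP value),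
`thm212_exists_isKatzLFunction` (Katz `L`-function exists) — PUBLISHED —, and [ALG]
`thm151_algmain_goodLattice_OPEN`, [AN] `thm222_anacong_goodLattice_OPEN`, [BRω]
`GoodLatticeOmegaSideOnTree`, [BR𝟙] `CharMainConjOnTree` — Keller–Yin's new content at an anomalous
prime, PREPRINT. Everything else (the characters `ω̃`, `𝟙̃` and their restriction to `K`, the
unramifiedness of `𝟙̃` outside `N` including at `p`, the Hecke character `θ_K`, the bookkeeping, the
Weierstrass dictionary, KY's assembly L1631–1640 and the halves algebra) is a kernel theorem.
CONDITIONAL; nothing booked; no label moves. [claim: KellerYin2024, status: under-review]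
[cite: KellerYin2024, Thm. 3.0.8 (IMC2), Thm. 1.5.1, Thm. 1.2.2, Thms. 2.2.1–2.2.3]
[cite: CastellaGrossiLeeSkinner2022, Thm. 2.1.2, proof of Thm. 4.2.2, Thm. 5.1.3]
[cite: CastellaHsieh2018, Def. 3.7 and Prop. 3.8] -/
theorem goodLatticeBDPValue_of_facts
    (hCH : castellaHsieh2018_exists_isBDPLFunction)
    (hC : ∀ (N : ℕ) [NeZero N], IsNewformOf.level_eq_conductorNorm (N := N))
    (hdiv : proofThm422_exists_isBDPLFunction_isTorsion_charIdeal_dvd)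
    (hval : thm513_exists_isBDPLFunction_valueAtOne)
    (hKatz : thm212_exists_isKatzLFunction)
    (halg : thm151_algmain_goodLattice_OPEN) (han : thm222_anacong_goodLattice_OPEN)
    (hω : ∀ (W : WeierstrassCurve ℚ) [W.IsElliptic] [W.IsGloballyMinimal] (p : ℕ) [Fact p.Prime],
      GoodLatticeOmegaSideOnTree W p)
    (hbr : ∀ (p : ℕ) [Fact p.Prime], CharMainConjOnTree p) :
    Summit.BirchSwinnertonDyer.BirchSwinnertonDyer.Theses.EisensteinPrimes.GoodLatticeBDPValue :=
  goodLatticeBDPValue_of_published_of_split hCH hC hdiv hval halg han hω hbr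
    (fun p _ ↦ katzLFunctionExistsFor_of_thm212 hKatz p)

end Summit.BirchSwinnertonDyer.BirchSwinnertonDyer.Theorems.EisensteinPrimesMuLambda

end
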